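import Summits.ABC.StewartYu.PadicG3ValuesGen
import Summits.ABC.StewartYu.SiegelOnFinset
import HarnessLib

/-!
# Cell abc-stewartyu, crux `Y07Odd` (stmt-ABC-19658), line `gen3-slab-odd`: the SIEGEL STEP for the generic class family —
# integer coefficients `pᵢ` with `g3φ τ x = 0` on a finite set of equations

`Summits/ABC/StewartYu/PadicG3SiegelGen.lean` — sequel to `PadicG3ValuesGen` (cell `abc-stewartyu`, seat p2-g4, F-odd lead).  One theorem on
`G3Setup`; no named fact.  Odd-`p` twin of p3-g5's `PadicG3TwoSiegel.exists_g3_siegel` in the `g3φ` currency of `PadicG3Functions` (the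
`(ℓ₀, λ)`/binomial-weight instance `PadicG3Siegel.siegel_slab` is the earlier, equivalent form): unknowns `i ∈ B` (signed exponent box
`|vᵢⱼ| ≤ Dⱼ`, directional scalars `|𝔛ₖ(vᵢ)| ≤ Xb`), equations `(x, τ) ∈ E` (nonempty, `2·#E ≤ #B`), POINTWISE `Y₀`-weight data
`den₀ e ≥ 1`, `den₀ e·(Hasse_{t₀} Rᵢ)(x) ∈ ℤ` of size `≤ M₀ e`, and `Amax ≥ M₀ e·Xb^{|t|}·monDen(α, D·|x|)²` on `E`: there is an integer vector
`p` supported in `B`, not all zero, `|pᵢ| ≤ ⌈#B·Amax⌉`, with `g3φ τ x = 0` for all `(x, τ) ∈ E` (`SiegelFinset.exists_int_vec_of_finset` on the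
cleared coefficients of `PadicG3ValuesGen.exists_int_clear_mul_coef`).

WHAT THIS IS NOT: no parameter choice (the record supplies `B = unk L₀ 𝔏`, `E`, `Amax`); no crux moves.

References: Yu. V. Nesterenko, LNM 1819 (2003), Prop. 3.9; K. Yu, Acta Math. 211 (2013), Lemma 4.2; C. L. Siegel 1929.
-/

noncomputable section

open Finset Polynomial
open Literature.NumberTheory.Transcendental
open Literature.NumberTheory.Transcendental.CW77.Setup (Tau tauNorm)

namespace Summit.ABC.StewartYu

namespace G3Setup

variable {p : ℕ} [Fact p.Prime] (S : G3Setup p) {ι : Type*} (R : ι → ℚ[X]) (v : ι → Fin S.n → ℤ)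

/-- **The Siegel step for the class family** (pointwise weight sizes). [cite: Nesterenko2003, Prop 3.9] [cite: Yu2013, Lemma 4.2] -/
theorem exists_g3_siegel [DecidableEq ι] (B : Finset ι) (E : Finset (ℤ × Tau S.n)) (hE : E.Nonempty)
    (hcard : 2 * E.card ≤ B.card)
    {Dbox : Fin S.n → ℕ} (hv : ∀ i ∈ B, ∀ j, |v i j| ≤ (Dbox j : ℤ))
    (den₀ : ℤ × Tau S.n → ℕ) (hden₀ : ∀ e ∈ E, 1 ≤ den₀ e) (M₀ : ℤ × Tau S.n → ℤ)
    (hR : ∀ e ∈ E, ∀ i ∈ B,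
      ∃ z₀ : ℤ, (den₀ e : ℚ) * (hasseDeriv e.2.1 (R i)).eval (e.1 : ℚ) = z₀ ∧ |z₀| ≤ M₀ e)
    {Xb : ℤ} (hX : ∀ i ∈ B, ∀ k, |S.𝔛 (v i) k| ≤ Xb)
    {Amax : ℝ} (hAmax : 1 ≤ Amax)
    (hA : ∀ e ∈ E, (M₀ e : ℝ) * (Xb : ℝ) ^ (∑ k, e.2.2 k) * ((MonomialDen.monDen S.α (S.boxExpG Dbox e.1) : ℝ)) ^ 2 ≤ Amax) :
    ∃ pv : ι → ℤ, (∀ i, pv i ≠ 0 → i ∈ B) ∧ (∃ i, pv i ≠ 0) ∧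
      (∀ i, |pv i| ≤ ⌈(B.card : ℝ) * Amax⌉) ∧
      ∀ e ∈ E, S.g3φ R v B pv e.2 e.1 = 0 := by
  classical
  -- the system: coefficient of the unknown `i` in the equation `e = (x, τ)`
  set coeff : ℤ × Tau S.n → ι → ℚ := fun e i =>
    (hasseDeriv e.2.1 (R i)).eval (e.1 : ℚ) * S.zγpow v i e.2.2 * ∏ j, S.α j ^ (v i j * e.1) with hcoeff
  -- the clearing denominators
  set Dc : ℤ × Tau S.n → ℕ := fun e =>
    den₀ e * (S.b S.j₀).natAbs ^ (∑ k, e.2.2 k) * MonomialDen.monDen S.α (S.boxExpG Dbox e.1) with hDc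
  have hb1 : 1 ≤ (S.b S.j₀).natAbs := Int.natAbs_pos.mpr S.bj₀_ne
  have hDpos : ∀ e ∈ E, 0 < Dc e := by
    intro e he
    have hmon1 : 1 ≤ MonomialDen.monDen S.α (S.boxExpG Dbox e.1) := MonomialDen.one_le_monDen _ S.α_ne _
    have : 1 ≤ Dc e := one_le_mul (one_le_mul (hden₀ e he) (Nat.one_le_pow _ _ hb1)) hmon1
    omega
  -- integrality and size of the cleared coefficients
  have hclear : ∀ e ∈ E, ∀ i ∈ B, ∃ z : ℤ, (Dc e : ℚ) * coeff e i = z ∧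
      |z| ≤ M₀ e * Xb ^ (∑ k, e.2.2 k) * ((MonomialDen.monDen S.α (S.boxExpG Dbox e.1) : ℤ)) ^ 2 := by
    intro e he i hi
    exact S.exists_int_clear_mul_coef R v i (hv i hi) e.2 e.1 (hR e he i hi) (hX i hi)
  have hint : ∀ e ∈ E, ∀ i ∈ B, ∃ z : ℤ, (Dc e : ℚ) * coeff e i = z :=
    fun e he i hi => by obtain ⟨z, hz, _⟩ := hclear e he i hi; exact ⟨z, hz⟩
  have hAbound : ∀ e ∈ E, ∀ i ∈ B, ((|(Dc e : ℚ) * coeff e i| : ℚ) : ℝ) ≤ Amax := by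
    intro e he i hi
    obtain ⟨z, hz, hzle⟩ := hclear e he i hi
    rw [hz]
    push_cast
    have h1 : |(z : ℝ)| ≤ (M₀ e : ℝ) * (Xb : ℝ) ^ (∑ k, e.2.2 k) * ((MonomialDen.monDen S.α (S.boxExpG Dbox e.1) : ℝ)) ^ 2 := by
      have := (Int.cast_le (R := ℝ)).mpr hzle
      push_cast at this
      exact this
    exact h1.trans (hA e he)
  obtain ⟨pv, hsupp, hne, hbound, hsol⟩ :=
    SiegelFinset.exists_int_vec_of_finset B E hE hcard coeff Dc hDpos hint hAmax hAbound
  refine ⟨pv, hsupp, hne, hbound, fun e he => ?_⟩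
  have h := hsol e he
  unfold g3φ
  rw [← h]
  refine Finset.sum_congr rfl fun i _ => ?_
  simp only [hcoeff]
  ring

end G3Setup

end Summit.ABC.StewartYu

end
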